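import Mathlib
import Summits.Ventures.HodgeRepro.Tier4.Target
import Summits.Ventures.HodgeRepro.Tier4.Line3.WittSymm

/-!
# Tier4/Line3/GramCongruence — the Gram deviation of a tuple in a congruence ball (rung for L3.4 / L3.5)

Blind re-derivation cell `pub-hodge-repro`, Tier 4 «PROVE THE STEP» (README §9–§10), LINE L3 (orbit expansion of the
quadruple theta period), seat t4-L2-p3 on L3.5 `term_dominated` (lead S12234).

STEP 5 of the line needs: a tuple `x` congruent to the main tuple `xm` modulo `I • L₀` (`I = (𝔭 𝔭̄)^N`, the two-sided
depth-`N` ball, S12366 / S12397) has Gram entries congruent to those of `xm` modulo `I • 𝔞`, for ONE fixed finitely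
generated `𝒪`-submodule `𝔞 ⊆ E′` built from `L₀` and `xm` — so that a NON-ZERO deviation (off-main, by the landed
`witt_symm_of_gram`) is an element of `I • 𝔞 ∖ {0}` and the archimedean-size rung (`ArchSize.rung_archimedean_size_of_denom`)
applies with the common denominator `D₀` of `𝔞`.

The hermitian form `⟨u, v⟩_H = c(u)ᵀ H v` is `bilH H R (conjVec c u) v` for the PLAIN `R`-bilinear form
`bilH H R u v = u ⬝ᵥ (H *ᵥ v)` (`R` any ring acting on `E`, e.g. `𝒪_{E′}`), and the conjugate `conjVec c u = c ∘ u`.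
Because the first slot is conjugate-linear, the congruence hypothesis is taken on `x − xm` AND on its conjugate
`conjVec c (x − xm)` (for a `c`-stable ideal `I` the two are the same condition up to `L ↔ L'`; for a split prime they are
the two components of the two-sided ball).  The Gram span is
`gramSpan c H R L L' xm := map₂ (bilH H R) (L' ⊔ span (conjVec c ∘ xm)) (L ⊔ span xm)` — finitely generated when
`L, L'` are (`gramSpan_fg`).

MAIN STATEMENT (`hform_sub_mem_smul`): `x j − xm j ∈ I • L` and `conjVec c (x j − xm j) ∈ I • L'` for all `j` imply
`⟨x i, x j⟩_H − ⟨xm i, xm j⟩_H ∈ I • gramSpan c H R L L' xm` for all `i, j`.  Proof: with `δ = x − xm`,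
`⟨x i, x j⟩ − ⟨xm i, xm j⟩ = bil(c̄δ_i, xm_j) + bil(c̄δ_i, δ_j) + bil(c̄ xm_i, δ_j)` and each term lies in `I • map₂ …` by
`Submodule.smul_induction_on` on the `I • L`-factor (`bilH_mem_smul_left/right`).

Also `mem_smul_of_smul_mem_smul`: for a `𝒪`-module `L₀` and a height-one prime `𝔭` of a Dedekind domain, `a ∉ 𝔭` and
`a • δ ∈ 𝔭^N • L₀` with `δ ∈ L₀` force `δ ∈ 𝔭^N • L₀` (`a` is invertible modulo `𝔭^N`: `y a + i = 1` with `i ∈ 𝔭`, raised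
to the `N`-th power) — the bridge from the skeleton's localised `InBall` (denominators prime to `𝔭`) to the global
congruence above, for tuples in the lattice.

Nothing here asserts anything about the truth of (P); HC_CM is NOT proved by anyone in this repository.
-/

set_option autoImplicit false

noncomputable section

namespace Summit.Ventures.HodgeRepro.Tier4.Line3

open Matrix

section GramCongruence

variable {E : Type*} [Field E] (c : E ≃+* E) (H : Matrix (Fin 3) (Fin 3) E)
variable (R : Type*) [CommRing R] [Algebra R E]

/-- The plain `R`-bilinear form `(u, v) ↦ u ⬝ᵥ (H *ᵥ v)` on `E³`. -/
def bilH : (Fin 3 → E) →ₗ[R] (Fin 3 → E) →ₗ[R] E :=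
  LinearMap.mk₂ R (fun u v => u ⬝ᵥ (H *ᵥ v))
    (fun u₁ u₂ v => add_dotProduct u₁ u₂ _)
    (fun r u v => smul_dotProduct r u _)
    (fun u v₁ v₂ => by rw [Matrix.mulVec_add, dotProduct_add])
    (fun r u v => by rw [Matrix.mulVec_smul, dotProduct_smul])

/-- `bilH H R u v = u ⬝ᵥ (H *ᵥ v)`. -/
@[simp] theorem bilH_apply (u v : Fin 3 → E) : bilH H R u v = u ⬝ᵥ (H *ᵥ v) := rfl

/-- The coordinatewise conjugate `c ∘ x` of a vector. -/
def conjVec (x : Fin 3 → E) : Fin 3 → E := fun k => c (x k)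

/-- `conjVec` is additive. -/
theorem conjVec_add (x y : Fin 3 → E) : conjVec c (x + y) = conjVec c x + conjVec c y := by
  funext k
  simp [conjVec, map_add]

/-- `conjVec` respects subtraction. -/
theorem conjVec_sub (x y : Fin 3 → E) : conjVec c (x - y) = conjVec c x - conjVec c y := by
  funext k
  simp [conjVec, map_sub]

/-- The hermitian form is the plain bilinear form on the conjugate of the first vector. -/
theorem hform_eq_bilH (x y : Fin 3 → E) : hform c H x y = bilH H R (conjVec c x) y := rfl

/-- **The Gram span** of a lattice pair `(L, L')` and the main tuple `xm`: the `R`-span of all `bilH`-values on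
`(L' ⊔ span (c̄ xm)) × (L ⊔ span xm)`. -/
def gramSpan (L L' : Submodule R (Fin 3 → E)) (xm : Fin 4 → Fin 3 → E) : Submodule R E :=
  Submodule.map₂ (bilH H R) (L' ⊔ Submodule.span R (Set.range fun i => conjVec c (xm i)))
    (L ⊔ Submodule.span R (Set.range xm))

/-- The Gram span of finitely generated lattices is finitely generated (so it has a common denominator). -/
theorem gramSpan_fg {L L' : Submodule R (Fin 3 → E)} (hL : L.FG) (hL' : L'.FG) (xm : Fin 4 → Fin 3 → E) :
    (gramSpan c H R L L' xm).FG :=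
  Submodule.FG.map₂ _ (hL'.sup (Submodule.fg_span (Set.finite_range _)))
    (hL.sup (Submodule.fg_span (Set.finite_range _)))

/-- `bilH u v ∈ I • map₂ bilH M₁ M₂` when `u ∈ I • N` with `N ≤ M₁` and `v ∈ M₂`. -/
theorem bilH_mem_smul_left {I : Ideal R} {N M₁ M₂ : Submodule R (Fin 3 → E)} (hN : N ≤ M₁) {u v : Fin 3 → E}
    (hu : u ∈ I • N) (hv : v ∈ M₂) : bilH H R u v ∈ I • Submodule.map₂ (bilH H R) M₁ M₂ := by
  refine Submodule.smul_induction_on hu (fun r hr n hn => ?_) (fun a b ha hb => ?_)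
  · rw [LinearMap.map_smul₂]
    exact Submodule.smul_mem_smul hr (Submodule.apply_mem_map₂ _ (hN hn) hv)
  · rw [LinearMap.map_add₂]
    exact Submodule.add_mem _ ha hb

/-- `bilH u v ∈ I • map₂ bilH M₁ M₂` when `u ∈ M₁` and `v ∈ I • N` with `N ≤ M₂`. -/
theorem bilH_mem_smul_right {I : Ideal R} {N M₁ M₂ : Submodule R (Fin 3 → E)} (hN : N ≤ M₂) {u v : Fin 3 → E}
    (hu : u ∈ M₁) (hv : v ∈ I • N) : bilH H R u v ∈ I • Submodule.map₂ (bilH H R) M₁ M₂ := by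
  refine Submodule.smul_induction_on hv (fun r hr n hn => ?_) (fun a b ha hb => ?_)
  · rw [map_smul]
    exact Submodule.smul_mem_smul hr (Submodule.apply_mem_map₂ _ hu (hN hn))
  · rw [map_add]
    exact Submodule.add_mem _ ha hb

/-- **GRAM CONGRUENCE.** If `x ≡ xm` and `c̄ x ≡ c̄ xm` modulo `I • L` resp. `I • L'` (coordinate by coordinate of the
quadruple), every Gram entry of `x` is congruent to that of `xm` modulo `I • gramSpan c H R L L' xm`. -/
theorem hform_sub_mem_smul (I : Ideal R) (L L' : Submodule R (Fin 3 → E)) (xm x : Fin 4 → Fin 3 → E)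
    (hx : ∀ j, x j - xm j ∈ I • L) (hcx : ∀ j, conjVec c (x j - xm j) ∈ I • L') (i j : Fin 4) :
    hform c H (x i) (x j) - hform c H (xm i) (xm j) ∈ I • gramSpan c H R L L' xm := by
  have hdev : hform c H (x i) (x j) - hform c H (xm i) (xm j) =
      bilH H R (conjVec c (x i - xm i)) (xm j) + bilH H R (conjVec c (x i - xm i)) (x j - xm j)
        + bilH H R (conjVec c (xm i)) (x j - xm j) := by
    simp only [hform_eq_bilH c H R, conjVec_sub, map_sub, LinearMap.sub_apply]
    abel
  rw [hdev]
  have hxm_j : xm j ∈ L ⊔ Submodule.span R (Set.range xm) :=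
    (le_sup_right : Submodule.span R (Set.range xm) ≤ _) (Submodule.subset_span ⟨j, rfl⟩)
  have hcxm_i : conjVec c (xm i) ∈ L' ⊔ Submodule.span R (Set.range fun i => conjVec c (xm i)) :=
    (le_sup_right : Submodule.span R (Set.range fun i => conjVec c (xm i)) ≤ _) (Submodule.subset_span ⟨i, rfl⟩)
  have hδ_j : x j - xm j ∈ L ⊔ Submodule.span R (Set.range xm) :=
    (le_sup_left : L ≤ _) (Submodule.smul_le_right (hx j))
  have h1 : bilH H R (conjVec c (x i - xm i)) (xm j) ∈ I • gramSpan c H R L L' xm :=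
    bilH_mem_smul_left H R le_sup_left (hcx i) hxm_j
  have h2 : bilH H R (conjVec c (x i - xm i)) (x j - xm j) ∈ I • gramSpan c H R L L' xm :=
    bilH_mem_smul_left H R le_sup_left (hcx i) hδ_j
  have h3 : bilH H R (conjVec c (xm i)) (x j - xm j) ∈ I • gramSpan c H R L L' xm :=
    bilH_mem_smul_right H R le_sup_left hcxm_i (hx j)
  exact Submodule.add_mem _ (Submodule.add_mem _ h1 h2) h3

end GramCongruence

section Localised

variable {R : Type*} [CommRing R] [IsDedekindDomain R] {M : Type*} [AddCommGroup M] [Module R M]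

/-- **From the localised ball to the global one.** For `δ ∈ L₀`, `a ∉ 𝔭` and `a • δ ∈ 𝔭^N • L₀`, already
`δ ∈ 𝔭^N • L₀`: `a` is invertible modulo `𝔭^N` (`y a + i = 1` with `i ∈ 𝔭`, and `(y a + i)^N = 1` has every term but
`i^N` divisible by `a`). -/
theorem mem_smul_of_smul_mem_smul (p : IsDedekindDomain.HeightOneSpectrum R) (N : ℕ) (L₀ : Submodule R M)
    {a : R} (ha : a ∉ p.asIdeal) {δ : M} (hδ : δ ∈ L₀) (h : a • δ ∈ p.asIdeal ^ N • L₀) :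
    δ ∈ p.asIdeal ^ N • L₀ := by
  obtain ⟨y, i, hi, hyi⟩ := p.isMaximal.exists_inv ha
  -- `1 = (y a + i)^N = Σ_k C(N,k) (y a)^k i^(N-k)`
  have hpow : (1 : R) = ∑ k ∈ Finset.range (N + 1), (y * a) ^ k * i ^ (N - k) * (N.choose k : R) := by
    rw [← add_pow, hyi, one_pow]
  have hδ' : δ = ∑ k ∈ Finset.range (N + 1), ((y * a) ^ k * i ^ (N - k) * (N.choose k : R)) • δ := by
    rw [← Finset.sum_smul, ← hpow, one_smul]
  rw [hδ']
  refine Submodule.sum_mem _ fun k hk => ?_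
  rcases Nat.eq_zero_or_pos k with hk0 | hkpos
  · -- the `k = 0` term: `i^N • δ` with `i^N ∈ 𝔭^N`
    subst hk0
    simp only [pow_zero, one_mul, Nat.sub_zero, Nat.choose_zero_right, Nat.cast_one, mul_one]
    exact Submodule.smul_mem_smul (Ideal.pow_mem_pow hi N) hδ
  · -- the terms with `k ≥ 1`: multiples of `a • δ`
    obtain ⟨k', rfl⟩ : ∃ k', k = k' + 1 := ⟨k - 1, by omega⟩
    have e : ((y * a) ^ (k' + 1) * i ^ (N - (k' + 1)) * (N.choose (k' + 1) : R)) • δ =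
        ((y * a) ^ k' * y * i ^ (N - (k' + 1)) * (N.choose (k' + 1) : R)) • (a • δ) := by
      rw [smul_smul]
      congr 1
      ring
    rw [e]
    exact Submodule.smul_mem _ _ h

end Localised

end Summit.Ventures.HodgeRepro.Tier4.Line3

end
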